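import Summits.CriticalPhenomena.PercolationContinuityZ3.Theorems.SahiMasterFamilyGluedFramesZero

/-!
# Glued frames, V: at least two pure members (every order)

Unit `prim-master-conj` (crux anchor stmt-CriticalPhenomena-4575), gen 11; memo HOME/prim-master-conj/TIGHTNESS-III.md §2.3–§2.4 and §5
("|P| ≥ 2" is order-free).  Setting of the local-to-global problem: a family `U` on `W` (all of `κ`) of non-empty increasing events whose
contraction faces are structured, whose glued frames (`gframe`) have pairwise disjoint essential supports, and whose deletion faces at
CORE-FREE coordinates are structured and consistent (`FaceFConsistent`).  If some coordinate is core-free then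

  **`two_le_card_pure`**: at least two members are PURE (glued annihilator empty).

Proof (TIGHTNESS-III 2.3–2.4, generalised): a deletion face at a core-free `f₀` has two pure members (`exists_two_pure`); unless both are
globally pure, one is a non-pure OWNER `x` of `f₀` (`mem_esupp_of_pure_in_faceF`), so `f₀` is a vertex of `gframe x`.  Every vertex `g` of
`gframe x` is core-free (`coreFree_of_mem_verts`); in the deletion face at `g` either `x` is pure — then every point of `gann x` contains `g`
(`forall_mem_of_pure_in_faceF`) — or a second non-pure owner of `g` exists, impossible by support-disjointness (`owner_unique`-style).  So every
point of `gann x` contains every vertex of `gframe x`, and the VERTEX LEMMA (`verts_eq_empty_of_downClosed`) empties the vertex set —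
contradicting `f₀`.  Pure combinatorics; axioms standard. [this work]
-/

noncomputable section

open scoped Classical

namespace Summit.CriticalPhenomena.PercolationContinuityZ3.Theorems

namespace GluedFrames

open Finset Function
open Literature.Probability.LatticeModels.Kahn2022 (Affects)

variable {ι : Type*} [Fintype ι] {κ : Type*} (U : κ → Set (Set ι)) (W : Finset κ)

/-- A member pure in the deletion face at the core-free `f` is globally pure or an OWNER of `f` (`f` in the support of its glued frame).
[this work] -/
theorem pure_or_owner (hU : ∀ k, IsUpperSet (U k)) {f : ι} (hc : FaceFConsistent U W f) {x : κ} (hx : x ∈ W)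
    (hpure : cframe (faceF U f) W x ⊆ faceF U f x) : gann U W x = ∅ ∨ f ∈ esupp (gframe U W x) := by
  by_cases hN : (gann U W x).Nonempty
  · exact Or.inr (mem_esupp_of_pure_in_faceF U W hU hc hx hpure hN)
  · exact Or.inl (Set.not_nonempty_iff_eq_empty.1 hN)

/-- **At least two pure members** (TIGHTNESS-III 2.3–2.4, every order).  See the module docstring. [this work] -/
theorem two_le_card_pure (hU : ∀ k, IsUpperSet (U k)) (hne : ∀ k, (U k).Nonempty) (hWU : ∀ k, k ∈ W)
    (hS : ∀ h, Structured (faceT U h) W)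
    (hd : ∀ w ∈ W, ∀ w' ∈ W, w ≠ w' → Disjoint (esupp (gframe U W w)) (esupp (gframe U W w')))
    (hF : ∀ f, CoreFree U f → Structured (faceF U f) W ∧ FaceFConsistent U W f)
    (hE0 : ∃ f, CoreFree U f) (h2 : 2 ≤ W.card) (hι : ∀ f : ι, ∃ h, h ≠ f) :
    2 ≤ (W.filter fun w => gann U W w = ∅).card := by
  by_contra hlt
  push Not at hlt
  -- fewer than two pure members: any two distinct members contain a non-pure one
  have hP1 : ∀ a ∈ W, ∀ b ∈ W, a ≠ b → gann U W a = ∅ → gann U W b = ∅ → False := by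
    intro a ha b hb hab hpa hpb
    have hsub : ({a, b} : Finset κ) ⊆ W.filter fun w => gann U W w = ∅ := by
      intro x hx
      rcases mem_insert.1 hx with rfl | hx
      · exact mem_filter.2 ⟨ha, hpa⟩
      · rw [mem_singleton] at hx; subst hx; exact mem_filter.2 ⟨hb, hpb⟩
    have := card_le_card hsub
    rw [card_pair hab] at this
    omega
  -- in the deletion face at a core-free `f`, some pure-in-face member is a non-pure owner of `f`, unless `x` itself is pure there
  have howner : ∀ f, CoreFree U f → ∀ x ∈ W, ¬ (cframe (faceF U f) W x ⊆ faceF U f x) →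
      ∃ y ∈ W, y ≠ x ∧ (gann U W y).Nonempty ∧ f ∈ esupp (gframe U W y) := by
    intro f hf x hx hxnp
    obtain ⟨hFs, hFc⟩ := hF f hf
    have hΦU := isUpperSet_faceF U hU f
    have hΦne := faceF_nonempty U hf
    obtain ⟨a, ha, b, hb, hab, hfa, hfb⟩ := exists_two_pure (faceF U f) hΦU hΦne hFs h2
    have hax : a ≠ x := fun e => hxnp (e ▸ hfa.le)
    have hbx : b ≠ x := fun e => hxnp (e ▸ hfb.le)
    rcases pure_or_owner U W hU hFc ha hfa.le with hpa | hoa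
    · rcases pure_or_owner U W hU hFc hb hfb.le with hpb | hob
      · exact absurd (hP1 a ha b hb hab hpa hpb) id
      · exact ⟨b, hb, hbx, Set.nonempty_iff_ne_empty.2 fun h => hP1 a ha b hb hab hpa h |>.elim, hob⟩
    · refine ⟨a, ha, hax, Set.nonempty_iff_ne_empty.2 fun h => ?_, hoa⟩
      -- `a` pure globally: then `f ∉ esupp`?  No: use the second member instead
      rcases pure_or_owner U W hU hFc hb hfb.le with hpb | hob
      · exact hP1 a ha b hb hab h hpb
      · exact Finset.disjoint_left.1 (hd a ha b hb hab) hoa hob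
  -- Step 1: an owner `x` of a core-free `f₀`
  obtain ⟨f₀, hf₀⟩ := hE0
  obtain ⟨x, hx, hxN, hf₀x⟩ : ∃ x ∈ W, (gann U W x).Nonempty ∧ f₀ ∈ esupp (gframe U W x) := by
    obtain ⟨hFs, hFc⟩ := hF f₀ hf₀
    obtain ⟨a, ha, b, hb, hab, hfa, hfb⟩ :=
      exists_two_pure (faceF U f₀) (isUpperSet_faceF U hU f₀) (faceF_nonempty U hf₀) hFs h2
    rcases pure_or_owner U W hU hFc ha hfa.le with hpa | hoa
    · rcases pure_or_owner U W hU hFc hb hfb.le with hpb | hob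
      · exact absurd (hP1 a ha b hb hab hpa hpb) id
      · exact ⟨b, hb, Set.nonempty_iff_ne_empty.2 fun h => hP1 a ha b hb hab hpa h, hob⟩
    · refine ⟨a, ha, Set.nonempty_iff_ne_empty.2 fun h => ?_, hoa⟩
      rcases pure_or_owner U W hU hFc hb hfb.le with hpb | hob
      · exact hP1 a ha b hb hab h hpb
      · exact Finset.disjoint_left.1 (hd a ha b hb hab) hoa hob
  -- Step 2: every point of `gann x` contains every vertex of `gframe x`
  have hV : ∀ χ ∈ gann U W x, ↑(verts (gframe U W x)) ⊆ χ := by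
    intro χ hχ g hg
    have hg' := mem_coe.1 hg
    have hgcf : CoreFree U g := coreFree_of_mem_verts U W hU hne hS hd hWU hι hx hg'
    obtain ⟨hGs, hGc⟩ := hF g hgcf
    by_cases hxp : cframe (faceF U g) W x ⊆ faceF U g x
    · exact forall_mem_of_pure_in_faceF U W hGc hx hxp hχ
    · obtain ⟨y, hy, hyx, hyN, hgy⟩ := howner g hgcf x hx hxp
      exact absurd (mem_verts.1 hg').1 fun hgx => Finset.disjoint_left.1 (hd x hx y hy (Ne.symm hyx)) hgx hgy
  -- the vertex lemma empties the vertex set of `gframe x`, contradicting `f₀`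
  have hempty := verts_eq_empty_of_downClosed (isUpperSet_gframe U W hU x) (fun χ hχ => hχ.1) hxN
    (fun χ hχ χ' hle hχ' => mem_gann_of_subset U W hU hχ hle hχ') hV
  have hf₀v : f₀ ∈ verts (gframe U W x) := mem_verts_gframe_of_coreFree U W hU hf₀ hf₀x
  rw [hempty] at hf₀v
  exact notMem_empty _ hf₀v

end GluedFrames

end Summit.CriticalPhenomena.PercolationContinuityZ3.Theorems
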